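import Summits.RiemannHypothesis.RiemannHypothesis.Theorems.SoloInformedGroundStateLeak
import Literature.NumberTheory.Automorphic.MeyerThetaFunctionalEquation

/-!
# Ground-state endgame, VII: the Poisson bound for the E-map sum

Solo programme `solo-RiemannHypothesis-informed`, session 2. For an even Schwartz seed `h` with
`h(0) = 0 = ∫ h`, the E-map sum `S_λ(u) = ∑_{n ≥ 1} h(n u/λ)` is half the theta function
`Θ*_h(t) = ∑_{n ≠ 0} h(n t)` at `t = u/λ`, and the theta functional equation
`Θ*_h(t) = t⁻¹ Θ*_{𝓕h}(t⁻¹)` (Poisson summation; the constant terms vanish by the two moment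
conditions) together with the rapid decay of `Θ*_{𝓕h}` at `+∞` gives the POISSON BOUND

* `norm_eMapFn_le_rpow`: `‖S_λ(u)‖ ≤ C_α (u/λ)^{α-1}` for all `u > 0`, every `α > 1`, with `C_α`
  independent of `λ`.

Consequences for the windowed E-map image `eMapFn h λ = 1_{(0,∞)} S_λ` of a seed supported in
`[-1, 1]`: it is bounded uniformly in `λ`, its Mellin transform is `λ^s ζ(s) 𝓜h(s)` for `Re s > 1`
and — by the E-map identity of parts V–VI — VANISHES AT EVERY NON-TRIVIAL ZERO of `ζ`
(`mellin_eMapFn_eq_zero_of_riemannZeta_eq_zero`).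
-/

noncomputable section

open Complex Filter Set Topology MeasureTheory Asymptotics
open scoped FourierTransform
open Literature.NumberTheory.LFunctions Literature.NumberTheory.Automorphic.Meyer

namespace Summit.RiemannHypothesis.RiemannHypothesis.Theorems

/-! ## The theta functional equation with vanishing constant terms -/

/-- For an even Schwartz `h` with `h(0) = 0 = ∫ h`: `Θ*_h(t) = t⁻¹ Θ*_{𝓕h}(t⁻¹)` (`t > 0`), where
`Θ*_k(x) = ∑_{n ≠ 0} k(nx)` is `thetaRest k x`. -/
theorem thetaRest_eq_inv_mul_thetaRest_fourier (h : SchwartzMap ℝ ℂ) (heven : ∀ x, h (-x) = h x)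
    (h0 : h 0 = 0) (hint : ∫ x : ℝ, h x = 0) {t : ℝ} (ht : 0 < t) :
    thetaRest h t = (t⁻¹ : ℂ) * thetaRest (𝓕 h) t⁻¹ := by
  have hevenF : ∀ x, (𝓕 h : SchwartzMap ℝ ℂ) (-x) = (𝓕 h : SchwartzMap ℝ ℂ) x :=
    fourier_schwartz_even h heven
  have hF0 : (𝓕 h : SchwartzMap ℝ ℂ) 0 = 0 := by
    rw [SchwartzMap.fourier_coe, fourier_apply_zero, hint]
  have h1 := tsum_int_eq_add_thetaRest h heven ht
  have h2 := tsum_int_eq_add_thetaRest (𝓕 h) hevenF (inv_pos.2 ht)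
  have h3 := tsum_int_dilate_eq h ht
  rw [h0, zero_add] at h1
  rw [hF0, zero_add] at h2
  rw [← h1, h3, ← h2]
  congr 1
  refine tsum_congr fun n => ?_
  rw [SchwartzMap.fourier_coe, div_eq_inv_mul]

/-- RAPID DECAY OF `Θ*_h` AT `0⁺`: for an even Schwartz `h` with `h(0) = 0 = ∫ h` and any `α > 1`,
`‖Θ*_h(t)‖ ≤ C t^{α-1}` for all `t > 0`. -/
theorem norm_thetaRest_le_rpow (h : SchwartzMap ℝ ℂ) (heven : ∀ x, h (-x) = h x)
    (h0 : h 0 = 0) (hint : ∫ x : ℝ, h x = 0) {α : ℝ} (hα : 1 < α) :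
    ∃ C : ℝ, 0 ≤ C ∧ ∀ t : ℝ, 0 < t → ‖thetaRest h t‖ ≤ C * t ^ (α - 1) := by
  obtain ⟨C, hC⟩ := norm_apply_posClass_log_le_of_mem_weighted
    (meyerSum_ratTensor_unramified' (𝓕 h))
    (meyerSum_mem_ideleClassSchwartzWeighted_Ioi (ratTensor_mem_schwartzBruhatAdele (𝓕 h))) hα
  have hC0 : 0 ≤ C := by
    have := (norm_nonneg _).trans (hC 1 one_pos)
    simpa using this
  refine ⟨C, hC0, fun t ht => ?_⟩
  have hb : ‖thetaRest (𝓕 h) t⁻¹‖ ≤ C * t⁻¹ ^ (-α) := hC t⁻¹ (inv_pos.2 ht)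
  rw [thetaRest_eq_inv_mul_thetaRest_fourier h heven h0 hint ht, norm_mul,
    show ((t⁻¹ : ℂ)) = ((t⁻¹ : ℝ) : ℂ) by push_cast; rfl, Complex.norm_real, Real.norm_eq_abs,
    abs_of_pos (inv_pos.2 ht)]
  rw [Real.inv_rpow ht.le, ← Real.rpow_neg ht.le, neg_neg] at hb
  calc t⁻¹ * ‖thetaRest (𝓕 h) t⁻¹‖ ≤ t⁻¹ * (C * t ^ α) :=
        mul_le_mul_of_nonneg_left hb (inv_pos.2 ht).le
    _ = C * t ^ (α - 1) := by
        rw [Real.rpow_sub_one ht.ne']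
        field_simp

/-! ## The windowed E-map image and its Poisson bound -/

/-- The E-map image of the dilated seed, restricted to `(0, ∞)`:
`eMapFn h λ u = 1_{u > 0} ∑_{n ≥ 1} h(n u/λ)`. -/
def eMapFn (h : SchwartzMap ℝ ℂ) (lam : ℝ) : ℝ → ℂ :=
  (Ioi (0 : ℝ)).indicator fun u : ℝ => ∑' n : ℕ, h (((n + 1 : ℕ) : ℝ) * (lam⁻¹ * u))

/-- Value on `u > 0`. -/
theorem eMapFn_of_pos (h : SchwartzMap ℝ ℂ) (lam : ℝ) {u : ℝ} (hu : 0 < u) :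
    eMapFn h lam u = ∑' n : ℕ, h (((n + 1 : ℕ) : ℝ) * (lam⁻¹ * u)) :=
  indicator_of_mem (mem_Ioi.2 hu) _

/-- Value on `u ≤ 0`. -/
theorem eMapFn_of_nonpos (h : SchwartzMap ℝ ℂ) (lam : ℝ) {u : ℝ} (hu : u ≤ 0) :
    eMapFn h lam u = 0 :=
  indicator_of_notMem (fun hu' : u ∈ Ioi (0 : ℝ) => (not_lt.2 hu) hu') _

/-- Measurability. -/
theorem aestronglyMeasurable_eMapFn (h : SchwartzMap ℝ ℂ) {lam : ℝ} (hlam : 0 < lam) :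
    AEStronglyMeasurable (eMapFn h lam) volume :=
  aestronglyMeasurable_indicator_dilatedSum h hlam

/-- Continuity on `(0, ∞)`. -/
theorem continuousOn_eMapFn (h : SchwartzMap ℝ ℂ) {lam : ℝ} (hlam : 0 < lam) :
    ContinuousOn (eMapFn h lam) (Ioi 0) :=
  (continuousOn_dilatedSum h hlam).congr fun _ hu => eMapFn_of_pos h lam hu

/-- The E-map sum of a seed supported in `(-∞, 1]` vanishes beyond `u = λ`. -/
theorem eMapFn_eq_zero_of_lt (h : SchwartzMap ℝ ℂ) (hsupp : ∀ x : ℝ, 1 < x → h x = 0)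
    {lam : ℝ} (hlam : 0 < lam) {u : ℝ} (hu : lam < u) : eMapFn h lam u = 0 := by
  rw [eMapFn_of_pos h lam (hlam.trans hu)]
  exact dilatedSum_eq_zero_of_lt h hsupp hlam hu

/-- The E-map sum as half a theta function: `S_λ(u) = ½ Θ*_h(u/λ)` for even `h`, `u > 0`. -/
theorem eMapFn_eq_half_thetaRest (h : SchwartzMap ℝ ℂ) (heven : ∀ x, h (-x) = h x)
    {lam : ℝ} (hlam : 0 < lam) {u : ℝ} (hu : 0 < u) :
    eMapFn h lam u = (1 / 2 : ℂ) * thetaRest h (lam⁻¹ * u) := by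
  have ht : 0 < lam⁻¹ * u := by positivity
  rw [eMapFn_of_pos h lam hu, thetaRest_eq h ht,
    tsum_int_ite_eq_two_mul_tsum_nat (⇑h) heven (summable_schwartz_comp_nat_mul h ht)]
  ring

/-- **THE POISSON BOUND**, uniform in the dilation: for an even Schwartz seed with
`h(0) = 0 = ∫ h` and every `α > 1` there is `C_α` with `‖S_λ(u)‖ ≤ C_α (u/λ)^{α-1}` for all
`λ > 0`, `u > 0`. -/
theorem norm_eMapFn_le_rpow (h : SchwartzMap ℝ ℂ) (heven : ∀ x, h (-x) = h x)
    (h0 : h 0 = 0) (hint : ∫ x : ℝ, h x = 0) {α : ℝ} (hα : 1 < α) :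
    ∃ C : ℝ, 0 ≤ C ∧ ∀ lam : ℝ, 0 < lam → ∀ u : ℝ, 0 < u →
      ‖eMapFn h lam u‖ ≤ C * (lam⁻¹ * u) ^ (α - 1) := by
  obtain ⟨C, hC0, hC⟩ := norm_thetaRest_le_rpow h heven h0 hint hα
  refine ⟨C / 2, by positivity, fun lam hlam u hu => ?_⟩
  rw [eMapFn_eq_half_thetaRest h heven hlam hu, norm_mul]
  have hb := hC (lam⁻¹ * u) (by positivity)
  calc ‖(1 / 2 : ℂ)‖ * ‖thetaRest h (lam⁻¹ * u)‖ ≤ 1 / 2 * (C * (lam⁻¹ * u) ^ (α - 1)) := by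
        rw [show ‖(1 / 2 : ℂ)‖ = 1 / 2 by norm_num]
        exact mul_le_mul_of_nonneg_left hb (by norm_num)
    _ = C / 2 * (lam⁻¹ * u) ^ (α - 1) := by ring

/-- Uniform boundedness: for a seed as above supported in `[-1, 1]`, `‖eMapFn h λ u‖ ≤ C` for all
`λ > 0` and all `u` (the constant of `norm_eMapFn_le_rpow` with `α = 2`). -/
theorem norm_eMapFn_le_const (h : SchwartzMap ℝ ℂ) (heven : ∀ x, h (-x) = h x)
    (h0 : h 0 = 0) (hint : ∫ x : ℝ, h x = 0) (hsupp : ∀ x : ℝ, 1 < x → h x = 0) :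
    ∃ C : ℝ, 0 ≤ C ∧ ∀ lam : ℝ, 0 < lam → ∀ u : ℝ, ‖eMapFn h lam u‖ ≤ C := by
  obtain ⟨C, hC0, hC⟩ := norm_eMapFn_le_rpow h heven h0 hint one_lt_two
  refine ⟨C, hC0, fun lam hlam u => ?_⟩
  rcases le_or_gt u 0 with hu | hu
  · rw [eMapFn_of_nonpos h lam hu, norm_zero]; exact hC0
  rcases le_or_gt u lam with hul | hul
  · refine (hC lam hlam u hu).trans ?_
    have h1 : lam⁻¹ * u ≤ 1 := by rw [inv_mul_le_iff₀ hlam]; simpa using hul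
    have : (lam⁻¹ * u) ^ ((2 : ℝ) - 1) ≤ 1 := by
      rw [show (2 : ℝ) - 1 = 1 by norm_num, Real.rpow_one]; exact h1
    calc C * (lam⁻¹ * u) ^ ((2 : ℝ) - 1) ≤ C * 1 := mul_le_mul_of_nonneg_left this hC0
      _ = C := mul_one C
  · rw [eMapFn_eq_zero_of_lt h hsupp hlam hul, norm_zero]; exact hC0

/-! ## Mellin transform of the E-map image -/

/-- Riemann's unfolding: `mellin (eMapFn h λ) s = λ^s ζ(s) 𝓜h(s)` for `Re s > 1`. -/
theorem mellin_eMapFn_eq (h : SchwartzMap ℝ ℂ) {lam : ℝ} (hlam : 0 < lam) {s : ℂ} (hs : 1 < s.re) :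
    mellin (eMapFn h lam) s = (lam : ℂ) ^ s * riemannZeta s * mellin (fun x : ℝ => h x) s := by
  rw [← mellin_dilatedSum_eq h hlam hs]
  exact mellin_congr_Ioi' (fun t ht => eMapFn_of_pos h lam ht) s

/-- **THE E-MAP IMAGE IS MELLIN-ORTHOGONAL TO THE ZEROS**: for an even Schwartz seed with
`h(0) = 0 = ∫ h` supported in `[-1, 1]`, the (absolutely convergent) Mellin transform of
`eMapFn h λ` vanishes at every `ρ` with `0 < Re ρ`, `ρ ≠ 1`, `ζ(ρ) = 0` — in particular at every
non-trivial zero. (Window part `= −` leak part, parts V–VI.) -/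
theorem mellin_eMapFn_eq_zero_of_riemannZeta_eq_zero (h : SchwartzMap ℝ ℂ)
    (heven : ∀ x, h (-x) = h x) (h0 : h 0 = 0) (hint : ∫ x : ℝ, h x = 0)
    (hsupp : ∀ x : ℝ, 1 < x → h x = 0) {lam : ℝ} (hlam : 0 < lam)
    {ρ : ℂ} (hρ : 0 < ρ.re) (hρ1 : ρ ≠ 1) (hζ : riemannZeta ρ = 0) :
    mellin (eMapFn h lam) ρ = 0 := by
  obtain ⟨C, -, hC⟩ := norm_eMapFn_le_const h heven h0 hint hsupp
  have hSm := aestronglyMeasurable_eMapFn h hlam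
  have hSb : ∀ u : ℝ, 0 < u → ‖eMapFn h lam u‖ ≤ C := fun u _ => hC lam hlam u
  have hS0 : ∀ u : ℝ, lam + 1 ≤ u → eMapFn h lam u = 0 := fun u hu =>
    eMapFn_eq_zero_of_lt h hsupp hlam (by linarith)
  have hadd := mellin_eq_indicator_add one_pos hSm hSb hS0 hρ
  have hwin := mellin_indicator_Ioi_eq_neg_leak_of_zero one_pos hSm hSb hS0
    (differentiableOn_mainTerm h hlam) (fun s hs => mellin_eMapFn_eq h hlam hs) hρ hρ1 (by simp [hζ])
  rw [hadd, hwin, add_neg_cancel]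

/-! ## Mellin convergence of bounded windowed functions -/

/-- A bounded measurable function vanishing off `(0, U]` is integrable. -/
theorem integrable_of_bdd_of_eq_zero {F : ℝ → ℂ} {C U : ℝ} (hFm : AEStronglyMeasurable F volume)
    (hFb : ∀ u, ‖F u‖ ≤ C) (hF0 : ∀ u, u ∉ Ioc 0 U → F u = 0) : Integrable F volume := by
  have hfeq : F = (Ioc 0 U).indicator F := by
    funext u
    by_cases hu : u ∈ Ioc 0 U
    · rw [indicator_of_mem hu]
    · rw [indicator_of_notMem hu, hF0 u hu]
  rw [hfeq]
  have hIO : IntegrableOn F (Ioc 0 U) volume :=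
    Measure.integrableOn_of_bounded (M := C) measure_Ioc_lt_top.ne hFm
      ((ae_restrict_mem measurableSet_Ioc).mono fun u _ => hFb u)
  exact hIO.integrable_indicator measurableSet_Ioc

/-- A bounded measurable function vanishing off `(0, U]` is Mellin-convergent on `0 < Re s`. -/
theorem mellinConvergent_of_bdd_of_eq_zero {F : ℝ → ℂ} {C U : ℝ}
    (hFm : AEStronglyMeasurable F volume) (hFb : ∀ u, ‖F u‖ ≤ C)
    (hF0 : ∀ u, u ∉ Ioc 0 U → F u = 0) {s : ℂ} (hs : 0 < s.re) : MellinConvergent F s := by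
  have hC : 0 ≤ C := (norm_nonneg _).trans (hFb 0)
  have hint := integrable_of_bdd_of_eq_zero hFm hFb hF0
  refine mellinConvergent_of_isBigO_rpow (a := s.re + 1) (b := 0)
    hint.integrableOn.locallyIntegrableOn ?_ (by linarith) ?_ (by simpa using hs)
  · have : F =ᶠ[atTop] fun _ => (0 : ℂ) := by
      filter_upwards [eventually_gt_atTop U] with u hu
      exact hF0 u fun h => (not_le.2 hu) h.2
    exact this.trans_isBigO (isBigO_zero _ _)
  · refine IsBigO.of_bound C ?_
    filter_upwards [self_mem_nhdsWithin] with u (hu : 0 < u)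
    rw [neg_zero, Real.rpow_zero, Real.norm_eq_abs, abs_one, mul_one]
    exact hFb u

/-- The E-map image is Mellin-convergent on `0 < Re s`. -/
theorem mellinConvergent_eMapFn (h : SchwartzMap ℝ ℂ) (heven : ∀ x, h (-x) = h x)
    (h0 : h 0 = 0) (hint : ∫ x : ℝ, h x = 0) (hsupp : ∀ x : ℝ, 1 < x → h x = 0)
    {lam : ℝ} (hlam : 0 < lam) {s : ℂ} (hs : 0 < s.re) : MellinConvergent (eMapFn h lam) s := by
  obtain ⟨C, -, hC⟩ := norm_eMapFn_le_const h heven h0 hint hsupp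
  refine mellinConvergent_of_bdd_of_eq_zero (U := lam + 1) (aestronglyMeasurable_eMapFn h hlam)
    (hC lam hlam) (fun u hu => ?_) hs
  rcases le_or_gt u 0 with hu' | hu'
  · exact eMapFn_of_nonpos h lam hu'
  · have : lam + 1 < u := by
      by_contra hle
      exact hu ⟨hu', not_lt.1 hle⟩
    exact eMapFn_eq_zero_of_lt h hsupp hlam (by linarith)

/-- SIZE OF A MELLIN TRANSFORM FROM POWER DECAY AT `0`: if `‖F u‖ ≤ M u^K` on `(0, U]` and `F`
vanishes beyond `U`, then `‖mellin F s‖ ≤ M U^{K + Re s}/(K + Re s)` for `0 < Re s`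
(no `1/Re s` blow-up when `K ≥ 1`). -/
theorem norm_mellin_le_of_pow_decay {F : ℝ → ℂ} {U M K : ℝ} (hU : 0 < U) (hK : 0 ≤ K)
    (hFb : ∀ u, 0 < u → u ≤ U → ‖F u‖ ≤ M * u ^ K) (hF0 : ∀ u, U < u → F u = 0)
    {s : ℂ} (hs : 0 < s.re) :
    ‖mellin F s‖ ≤ M * U ^ (K + s.re) / (K + s.re) := by
  have h1 : mellin F s = ∫ t : ℝ in Ioc 0 U, (t : ℂ) ^ (s - 1) • F t := by
    unfold mellin
    rw [← integral_indicator measurableSet_Ioc, ← integral_indicator measurableSet_Ioi]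
    refine integral_congr_ae (Eventually.of_forall fun t => ?_)
    by_cases ht : t ∈ Ioc 0 U
    · rw [indicator_of_mem ht, indicator_of_mem (mem_Ioi.2 ht.1)]
    · rw [indicator_of_notMem ht]
      by_cases ht' : t ∈ Ioi (0 : ℝ)
      · rw [indicator_of_mem ht']
        have hU' : U < t := by
          by_contra hle
          exact ht ⟨ht', not_lt.1 hle⟩
        rw [hF0 t hU', smul_zero]
      · rw [indicator_of_notMem ht']
  rw [h1]
  have hKs : 0 < K + s.re := by linarith
  have hbound : ∀ᵐ (t : ℝ) ∂(volume.restrict (Ioc (0 : ℝ) U)),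
      ‖((t : ℝ) : ℂ) ^ (s - 1) • F t‖ ≤ M * t ^ (K + s.re - 1) := by
    refine (ae_restrict_mem measurableSet_Ioc).mono fun t ht => ?_
    rw [norm_smul, norm_cpow_eq_rpow_re_of_pos ht.1, sub_re, one_re]
    calc t ^ (s.re - 1) * ‖F t‖ ≤ t ^ (s.re - 1) * (M * t ^ K) :=
          mul_le_mul_of_nonneg_left (hFb t ht.1 ht.2) (Real.rpow_nonneg ht.1.le _)
      _ = M * t ^ (K + s.re - 1) := by
          rw [show K + s.re - 1 = K + (s.re - 1) by ring, Real.rpow_add ht.1]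
          ring
  have hint : IntegrableOn (fun t : ℝ => M * t ^ (K + s.re - 1)) (Ioc 0 U) volume := by
    have := (intervalIntegral.intervalIntegrable_rpow' (a := 0) (b := U)
      (by linarith : -1 < K + s.re - 1)).1
    exact this.const_mul M
  calc ‖∫ t : ℝ in Ioc 0 U, (t : ℂ) ^ (s - 1) • F t‖
      ≤ ∫ t : ℝ in Ioc 0 U, M * t ^ (K + s.re - 1) := norm_integral_le_of_norm_le hint hbound
    _ = M * (U ^ (K + s.re) / (K + s.re)) := by
        rw [integral_const_mul, ← intervalIntegral.integral_of_le hU.le,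
          integral_rpow (Or.inl (by linarith : -1 < K + s.re - 1))]
        congr 1
        rw [sub_add_cancel, Real.zero_rpow hKs.ne', sub_zero]
    _ = M * U ^ (K + s.re) / (K + s.re) := by ring

end Summit.RiemannHypothesis.RiemannHypothesis.Theorems
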